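import Summits.ABC.IUTFork.Thm311RealFullPrintArch
import Summits.ABC.IUTFork.LDHPerPrimeReadingWitness
import Literature.IUT.LogThetaLattice.StripFrameWitness
import HarnessLib

/-!
# [IUTchIII] Theorem 3.11 at the real instantiation with print's archimedean structure — NON-VACUITY of the
# archimedean (Ind3) clause for EVERY number field

PROOF-ONLY companion (D-0012; no definitions) of `Thm311RealFullPrintArch` (abc-iut cell, Cor. 3.12 sub-crew,
seat abc-iut-c312-1 — the typer of [IUTchIII] Thm. 3.11 —, gen 5); TAKES NO SIDE on [IUTchIII] Cor. 3.12. Cell rule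
"vacuity-audit every fork-level hypothesis with a non-vacuity witness" applied to this seat's
`Real.full_statement_print_arch` (p419143): there the archimedean (Ind3)-containments of the typed Thm. 3.11 (ii)
("`⊆ 𝓘(^{S^±_{j+1}}𝒟^⊢_∞)`", the Hermitian unit ball of [IUTchIII] Prop. 3.2 (ii), kurims `paper:url-4b091feeb646`
p. 98–99 — abc-iut-w4-d001's `Real.archPkHermitian`) hold for print's single-place images. This file certifies
that they are CONTENTFUL at every number field `F`:

* `Real.archPkHermitian_ne_univ_of_archFibre` — print's archimedean integral structure is a PROPER subset of the
  real packet `𝓘^ℚ(^{S^±_{j+1}};𝒟^⊢_∞)` as soon as `F` has ONE archimedean place (always): the pure tensor of the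
  single-place vectors `4 ∈ K_{w₀}` has tensor-metric square `16^{j+1} > (π²)^{j+1}` (w4-d001's
  `Real.archPkHermitian_ne_univ` assumed two archimedean places, which an `F ⊇ ℚ(√−1)` of degree `2` does not have);
* `Real.tprodSingleImages_units_nonempty` / `…_shell_nonempty` / `ind3_arch_clause_contentful` — the single-place
  unit images of `Real.full_statement_print_arch` are INHABITED at every `v_ℚ` (so the containment
  `unitImage ⊆ 𝓘(…)` is not vacuous) and `𝓘(…)` excludes some packet elements (so it is not trivial);
* `Real.exists_fullSituation_statement_printArch` — CLOSED CERTIFICATE (abc-iut-w5-d236's `Thm311RealThetaPilotFree`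
  pattern over `ℚ` with the tree's pilot datum `PilotData.deepAt ℚ 2 5 …`, the L6 witness glue `twoGlue`/`twoLattice`,
  `FM := 𝟭`): for every Θ-pilot divisor assignment there is a full situation whose `Statement` holds AND whose
  archimedean (a)-integral structure is a PROPER subset of the packet (print's ball, not the trivial structure).

Classical linear algebra (`π < 4`); nothing here bears on [IUTchIII] Cor. 3.12. [claim: Mochizuki2012, status: disputed]
for the quoted structure. typed ≠ proved; instantiated ≠ endorsed.
-/

noncomputable section

open Set Function NumberField IsDedekindDomain PiTensorProduct

namespace Summit.ABC.IUTFork.Thm311.Real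

open Literature.IUT.LogThetaLattice Literature.IUT.LogVolume Literature.IUT.LogVolume.Prop15iii

variable {F : Type} [Field F] [NumberField F]
variable (X : PilotData F) (logv : PadicLogs F) (Aut Ism : ∀ x : Place F, Set (Carrier x ≃ₗ[ℚ] Carrier x))
  (hAut : ∀ x, LinearEquiv.refl ℚ (Carrier x) ∈ Aut x) (hIsm : ∀ x, LinearEquiv.refl ℚ (Carrier x) ∈ Ism x)
  [Fintype (ArchFibre X)]

omit [Fintype (ArchFibre X)] in
/-- The archimedean fibre is inhabited (every number field has an archimedean place; c312-5's
`ThetaIndex.fibre_nonempty`). [folklore] -/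
theorem archFibre_nonempty : Nonempty (ArchFibre X) :=
  let ⟨v, hv⟩ := (thetaIndex X).fibre_nonempty (infty X); ⟨⟨v, hv⟩⟩

/-- The tensor-metric square of the pure tensor of the single-place vectors `n ∈ K_{w₀}` is `(n²)^{j+1}`
(abc-iut-w4-d039's `tensorForm_tprod_self`; `archEmb` is an isometry). [folklore] -/
theorem tensorForm_archComparison_single [DecidableEq (ArchFibre X)] (j : (thetaIndex X).Label) (w₀ : ArchFibre X)
    (n : ℕ) :
    tensorForm ((thetaIndex X).Caps j) (ArchFibre X)
        (archComparison X logv Aut Ism hAut hIsm j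
          ((logShells X logv Aut Ism hAut hIsm).tprod j _ fun _ => Pi.single w₀ ((n : ℕ) : Carrier w₀.1)))
        (archComparison X logv Aut Ism hAut hIsm j
          ((logShells X logv Aut Ism hAut hIsm).tprod j _ fun _ => Pi.single w₀ ((n : ℕ) : Carrier w₀.1))) =
      ((n : ℝ) ^ 2) ^ ((j : ℕ) + 1) := by
  rw [archComparison_tprod, tensorForm_tprod_self]
  have h1 : archPacket1Map X logv Aut Ism hAut hIsm
        (Pi.single w₀ ((n : ℕ) : Carrier w₀.1) : (logShells X logv Aut Ism hAut hIsm).Packet1 (infty X)) =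
      Pi.single w₀ (archEmb X w₀ ((n : ℕ) : Carrier w₀.1)) := by
    rw [archPacket1Map_of_singlePlace X logv Aut Ism hAut hIsm (w := w₀) (fun w' hw' => Pi.single_eq_of_ne hw' _),
      Pi.single_eq_same]
  simp_rw [h1, dsInner_self_eq]
  have h2 : ∑ v, ‖(Pi.single w₀ (archEmb X w₀ ((n : ℕ) : Carrier w₀.1)) : ArchFibre X → ℂ) v‖ ^ 2 =
      (n : ℝ) ^ 2 := by
    rw [Fintype.sum_eq_single w₀ fun v hv => by rw [Pi.single_eq_of_ne hv, norm_zero, zero_pow two_ne_zero],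
      Pi.single_eq_same, norm_archEmb, norm_natCast_carrier]
  rw [h2, Finset.prod_const, Finset.card_univ, Fintype.card_fin]

/-- **PRINT'S ARCHIMEDEAN INTEGRAL STRUCTURE IS A PROPER SUBSET OF THE REAL PACKET, for every `F`**: the pure
tensor of the single-place vectors `4 ∈ K_{w₀}` (any archimedean `w₀`) lies outside `𝓘(^{S^±_{j+1}}𝒟^⊢_∞)`
(`16^{j+1} > (π²)^{j+1}`, `π < 4`). Strengthens w4-d001's `archPkHermitian_ne_univ` (two archimedean places) to
one. [claim: Mochizuki2012, status: disputed] -/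
theorem archPkHermitian_ne_univ_of_archFibre (j : (thetaIndex X).Label) :
    archPkHermitian X logv Aut Ism hAut hIsm j ≠ Set.univ := by
  classical
  obtain ⟨w₀⟩ := archFibre_nonempty X
  intro h
  have hmem : (logShells X logv Aut Ism hAut hIsm).tprod j _ (fun _ => Pi.single w₀ ((4 : ℕ) : Carrier w₀.1)) ∈
      archPkHermitian X logv Aut Ism hAut hIsm j := h ▸ Set.mem_univ _
  rw [mem_archPkHermitian_iff, mem_hermitianBallN_iff, tensorForm_archComparison_single, Fintype.card_fin] at hmem
  have hlt : Real.pi ^ 2 < ((4 : ℕ) : ℝ) ^ 2 := by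
    have := Real.pi_lt_four
    push_cast
    nlinarith [Real.pi_pos]
  exact absurd hmem (not_le.mpr (pow_lt_pow_left₀ hlt (by positivity) (Nat.succ_ne_zero _)))

/-- Hence the binder `archPkPrint` of `Thm311RealFullPrintArch` is a proper subset of the packet at `∞`.
[claim: Mochizuki2012, status: disputed] -/
theorem archPkPrint_infty_ne_univ (j : (thetaIndex X).Label) :
    archPkPrint X logv Aut Ism hAut hIsm j (infty X) ≠ Set.univ :=
  archPkHermitian_ne_univ_of_archFibre X logv Aut Ism hAut hIsm j

omit [Fintype (ArchFibre X)] in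
/-- **The single-place UNIT images at every `v_ℚ` are INHABITED** (the (Ind3)-images of
`Real.full_statement_print_arch` at `m' = 0`: abc-iut-w4-d029's `iterImage logv 0 = unitsSet`, which contains `1`;
every fibre of `𝕍(F) → 𝕍_ℚ` is nonempty). [folklore] -/
theorem tprodSingleImages_units_nonempty (j : (thetaIndex X).Label) (vQ : (thetaIndex X).VQ) :
    ((logShells X logv Aut Ism hAut hIsm).tprodSingleImages j vQ fun v => iterImage logv 0 v.1).Nonempty := by
  obtain ⟨v₀, hv₀⟩ := (thetaIndex X).fibre_nonempty vQ
  refine (logShells X logv Aut Ism hAut hIsm).tprodSingleImages_nonempty ⟨⟨v₀, hv₀⟩, ?_⟩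
  rw [iterImage_zero]
  exact unitsSet_nonempty v₀

omit [Fintype (ArchFibre X)] in
/-- The single-place SHELL images (the radius-`π` balls of (Ind3)) are inhabited at every `v_ℚ` (`1 ∈ O_v^× ⊆ I_v`
under the law `O_v ⊆ I_v`; at `∞`: `|1| ≤ π`). [folklore] -/
theorem tprodSingleImages_shell_nonempty (hlaw : LogvLaw logv) (j : (thetaIndex X).Label)
    (vQ : (thetaIndex X).VQ) :
    ((logShells X logv Aut Ism hAut hIsm).tprodSingleImages j vQ fun v => shell logv v.1).Nonempty := by
  obtain ⟨v₀, hv₀⟩ := (thetaIndex X).fibre_nonempty vQ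
  exact (logShells X logv Aut Ism hAut hIsm).tprodSingleImages_nonempty
    ⟨⟨v₀, hv₀⟩, (unitsSet_nonempty v₀).mono (unitsSet_subset_shell hlaw v₀)⟩

/-- **NON-VACUITY of the archimedean (Ind3) clause of `Real.full_statement_print_arch`, for every `F`**: at `∞`
the unit image is inhabited and the containing integral structure is proper — the containment
`unitImage ⊆ 𝓘(^{S^±_{j+1}}𝒟^⊢_∞)` is neither vacuous nor trivial. [claim: Mochizuki2012, status: disputed] -/
theorem ind3_arch_clause_contentful (j : (thetaIndex X).Label) :
    ((logShells X logv Aut Ism hAut hIsm).tprodSingleImages j (infty X) fun v => iterImage logv 0 v.1).Nonempty ∧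
      archPkPrint X logv Aut Ism hAut hIsm j (infty X) ≠ Set.univ :=
  ⟨tprodSingleImages_units_nonempty X logv Aut Ism hAut hIsm j (infty X),
    archPkPrint_infty_ne_univ X logv Aut Ism hAut hIsm j⟩

open CategoryTheory Literature.IUT.LogThetaLattice.Witness in
omit [Fintype (ArchFibre X)] in
/-- **CLOSED CERTIFICATE with print's archimedean structure** (abc-iut-w5-d236's pattern): over `ℚ` with the
tree's pilot datum `PilotData.deepAt ℚ 2 5 …`, the probability-weighted container, analytic logarithms, LGP
splitting monoids (`qroot := 0`, `ζ := 1`), empty `archSub`/`Mmod`/`region`, zero action, (iii)-objects from the L6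
witness glue `twoGlue`/`twoLattice`, `FM := 𝟭`: for EVERY Θ-pilot divisor assignment there is a full situation of
Theorem 3.11 whose typed `Statement` HOLDS and whose archimedean (a)-integral structure is a PROPER subset of the
packet at every line (print's Hermitian ball — `Real.full_statement_print_arch` + `archPkPrint_infty_ne_univ`).
[claim: Mochizuki2012, status: disputed] -/
theorem exists_fullSituation_statement_printArch
    (thetaDiv₀ : ℤ → ℤ →
      LgpDivisor ℚ (thetaIndex (PilotData.deepAt ℚ 2 5 Nat.prime_five le_rfl 1 one_pos)).lstar) :
    ∃ Sit : Summit.ABC.IUTFork.Thm311.FullSituation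
        (thetaIndex (PilotData.deepAt ℚ 2 5 Nat.prime_five le_rfl 1 one_pos)),
      Sit.Statement ∧ ∀ (n : ℤ) (j : (thetaIndex (PilotData.deepAt ℚ 2 5 Nat.prime_five le_rfl 1 one_pos)).Label),
        (Sit.D n).shellPk j (infty _) ≠ Set.univ := by
  haveI : Fintype (ArchFibre (PilotData.deepAt ℚ 2 5 Nat.prime_five le_rfl 1 one_pos)) := Fintype.ofFinite _
  refine ⟨_, full_statement_print_arch (PilotData.deepAt ℚ 2 5 Nat.prime_five le_rfl 1 one_pos) (fun _ _ => ∅)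
    (fun _ _ _ => 0) (fun _ => ∅) (fun _ _ _ _ => ∅) thetaDiv₀ twoGlue twoLattice (𝟭 (Core twoFrame.DHT))
    (fun _ => 0) (fun _ _ => 1), fun n j => ?_⟩
  show (MRData.ofShells _ (archPkPrint (PilotData.deepAt ℚ 2 5 Nat.prime_five le_rfl 1 one_pos) (analyticLogv ℚ)
      stripAutDH (ismDH (analyticLogv ℚ)) refl_mem_stripAutDH (refl_mem_ismDH (analyticLogv ℚ))) _ _ _ _ _ _).shellPk
      j (infty _) ≠ Set.univ
  rw [MRData.ofShells_shellPk_of_not_isNon _ _ _ _ _ _ _ _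
    (show ¬ (thetaIndex (PilotData.deepAt ℚ 2 5 Nat.prime_five le_rfl 1 one_pos)).IsNon (infty _) from id)]
  exact archPkPrint_infty_ne_univ _ _ _ _ _ _ j

end Summit.ABC.IUTFork.Thm311.Real

end
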